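import Mathlib
import Literature.NumberTheory.LFunctions.Zhang2022.Section16NsetRemovableR
import Literature.NumberTheory.LFunctions.Zhang2022.Section16Varpi2WeightSum
import Literature.NumberTheory.LFunctions.Zhang2022.Section14MeanSquareMajorant
import Literature.NumberTheory.LFunctions.Zhang2022.TypedSection16BLocal
import HarnessLib

/-!
# Zhang (2022) §16 p. 94: "the innermost sum in (16.14) is `1 + O(𝓛⁻⁷)`" in the local reading —
# `Typed.Section16B.Inline16_innerSum1614L` from the rough multiplicative majorant (R)

Topic `Literature/NumberTheory/LFunctions/Zhang2022` (Landau–Siegel audit tree; verdict-neutral).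
Y. Zhang, *Discrete mean estimates and the Landau–Siegel zero*, arXiv:2211.02515v1 (2022)
[Zhang2022LandauSiegel] — **an unrefereed manuscript under adjudication**; this file proves an EDGE
between typed claims about the manuscript's own objects and asserts nothing about its Theorems 1–2.
ZHANG-L WP16 (seat zl-w16-p8), Block A of leaf h16_16 (binder `Eq16_16R2E`), §16 p. 94, tex
L4626–L4630: "This implies that the innermost sum in (16.14) is equal to `1 + O(𝓛⁻⁷)`", node
`Typed.Section16B.Inline16_innerSum1614L` (file `TypedSection16BLocal`, local reading F16B-1):
for `n₁ ∈ 𝔫(𝔮)`, `n₁ < T`, `l₁ ∣ n₁`, `j ∈ {1,2}`,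
`Σ_{(l,𝔮)=1, l<2T²} ϖ₂ⱼ^loc(l)·g*(T²/(l₁l))/(l(l₁l)^{β₃}) = 1 + O(𝓛⁻⁷)`.

Route (ruling RT16-int-3 (e) / W16-S5: the printed intermediate u036 "`ϖ₂ⱼ(l) ≪ α₁ + O(ν(q))`" is not
used; consumers take the rough multiplicative majorant (R) and Lemma 3.1 directly):
`inline16_innerSum1614L_of_roughMajorant : (R) → Inline16_innerSum1614L c′`, where (R) — spelled
inline, the text of record (Sketch5 S8; hypothesis `hR` of the lane's
`inline16_nsetRemovable_core_of_roughMajorant`) — bounds `|ϖ₂ⱼ^loc(q^r)|τ₃(q^r)` at rough prime powers.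
* the term `l = 1` is `l₁^{−β₃}g*(T²/l₁) = 1 + O(|b₃|log T) + O(e^{−𝓛³⁰})` (`|l₁^{−ib₃} − 1| ≤ |b₃|log l₁`,
  `MeanSquareMajorant.norm_powI_sub_one_le`; `|b₃| ≤ 3(1+|c′|π)α`; `|g(y) − 1| ≤ ½e^{−𝓛³⁰log²y}` for
  `y = T²/l₁ ≥ T`, `GaussWeight.abs_gWeight_sub_one_le`), and `α𝓛^{1.1} = π𝓛^{−7.9} ≤ π𝓛⁻⁷`;
* the terms `l ≥ 2` are at most `Σ_{2≤l<2T², (l,𝔮)=1}|ϖ₂ⱼ^loc(l)|τ₃(l)/l ≤ e^x − 1 ≤ xe^x`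
  (`sum_rough_varpi2loc_tau3R_div_le`, zl-w16-p4) with
  `x ≤ 3Σ_{D⁴<q≤2T²}|ν(q)|²/q + C₀α·Σ_{q≤2T²}log q/q + 20C₀/D⁴ ≤ X₀𝓛⁻⁷`
  (Lemma 3.1 `Lemma31.lemma_3_1` under (A); `|ν(q)| ≤ |ν(q)|²` at primes; Mertens
  `sum_primesBelow_log_div_le`; `𝓛⁷ ≤ D⁴`) — the bookkeeping of `inline16_nsetRemovable_core_of_roughMajorant`
  run at `N = ⌈2T²⌉` instead of `⌈T⌉`.

## References
* Y. Zhang, arXiv:2211.02515v1 (2022), §16 (16.14)–(16.15) p. 94, tex L4620–L4631; §3 Lemma 3.1.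
  [cite: Zhang2022LandauSiegel, §16 p. 94 (u036–u037)]
-/

noncomputable section

open Complex Real Finset Filter Topology

namespace Literature.NumberTheory.LFunctions.Zhang2022.Typed.Section16B

open Literature.NumberTheory.LFunctions.Zhang2022
open Literature.NumberTheory.LFunctions.Zhang2022.Skeleton
open Literature.NumberTheory.LFunctions.Zhang2022.Typed.Section16A
open Literature.NumberTheory.LFunctions.Zhang2022.SmoothEulerMajorant

variable (c' : ℝ)

/-! ## §1. Sizes at `N = ⌈2T²⌉` -/

/-- Any real threshold on `𝓛 = log D` holds for all large `D`. [cite: Zhang2022LandauSiegel, §2 (2.1)] -/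
private theorem exists_forall_le_ell_is (M : ℝ) : ∃ D₀ : ℕ, ∀ D : ℕ, D₀ ≤ D → M ≤ ell D := by
  refine ⟨⌈Real.exp M⌉₊ + 1, fun D hD => ?_⟩
  have hD1 : (⌈Real.exp M⌉₊ : ℝ) + 1 ≤ D := by exact_mod_cast hD
  have hD0 : (0 : ℝ) < D := by linarith [Nat.le_ceil (Real.exp M), Real.exp_pos M]
  rw [ell, Real.le_log_iff_exp_le hD0]
  linarith [Nat.le_ceil (Real.exp M)]

/-- The sizes used below, for `𝓛 ≥ 4¹⁰`, with `N = ⌈2T²⌉`: `2 ≤ D`, `2 ≤ D⁴ − 1`, `D⁴ ≤ N`,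
`N ≤ e^{2(log D)⁹}`, `N ≤ T⁵`, `2 ≤ N`, `log(N+1) ≤ 2𝓛^{1.1} + 3`, `𝓛^{1.1} ≤ 𝓛²`, `1 ≤ T`.
[cite: Zhang2022LandauSiegel, §2 (2.6), (2.10)] -/
private theorem innerSum_sizes {D : ℕ} (hℓ : (4 : ℝ) ^ 10 ≤ ell D) :
    2 ≤ D ∧ 2 ≤ D ^ 4 - 1 ∧ D ^ 4 ≤ ⌈2 * bigT D ^ 2⌉₊ ∧
      ((⌈2 * bigT D ^ 2⌉₊ : ℕ) : ℝ) ≤ Real.exp (2 * Real.log D ^ 9) ∧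
      ((⌈2 * bigT D ^ 2⌉₊ : ℕ) : ℝ) ≤ bigT D ^ 5 ∧ 2 ≤ ⌈2 * bigT D ^ 2⌉₊ ∧
      Real.log ((⌈2 * bigT D ^ 2⌉₊ + 1 : ℕ) : ℝ) ≤ 2 * ell D ^ (1.1 : ℝ) + 3 ∧
      ell D ^ (1.1 : ℝ) ≤ ell D ^ 2 ∧ 1 ≤ bigT D := by
  have h410 : (4 : ℝ) ^ 10 = 1048576 := by norm_num
  have hℓ1 : 1 ≤ ell D := by linarith
  have hℓ0 : 0 < ell D := by linarith
  have hD0 : 0 < D := by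
    by_contra h
    have : D = 0 := by omega
    subst this
    simp [ell] at hℓ0
  have hDexp : (D : ℝ) = Real.exp (ell D) := by
    rw [ell, Real.exp_log (by exact_mod_cast hD0)]
  have hD2 : 2 ≤ D := by
    by_contra h
    have h1 : D = 1 := by omega
    subst h1
    simp [ell] at hℓ0
  have hD4r : ((D ^ 4 : ℕ) : ℝ) = Real.exp (4 * ell D) := by
    push_cast; rw [hDexp, ← Real.exp_nat_mul]; norm_num
  have hD42 : 2 ≤ D ^ 4 - 1 := by
    have : 16 ≤ D ^ 4 := by nlinarith [Nat.pow_le_pow_left hD2 4]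
    omega
  have hT : bigT D = Real.exp (ell D ^ (1.1 : ℝ)) := rfl
  have hsplit : ell D ^ (1.1 : ℝ) = ell D * ell D ^ (0.1 : ℝ) := by
    rw [show (1.1 : ℝ) = 1 + 0.1 by norm_num, Real.rpow_add hℓ0, Real.rpow_one]
  have h01 : (4 : ℝ) ≤ ell D ^ (0.1 : ℝ) := by
    have h4 : (4 : ℝ) = ((4 : ℝ) ^ 10) ^ (0.1 : ℝ) := by
      rw [show (0.1 : ℝ) = ((10 : ℕ) : ℝ)⁻¹ by norm_num]
      exact (Real.pow_rpow_inv_natCast (by norm_num) (by norm_num)).symm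
    rw [h4]
    exact Real.rpow_le_rpow (by positivity) hℓ (by norm_num)
  have h11ge : 4 * ell D ≤ ell D ^ (1.1 : ℝ) := by rw [hsplit]; nlinarith
  have h11le2 : ell D ^ (1.1 : ℝ) ≤ ell D ^ 2 := by
    calc ell D ^ (1.1 : ℝ) ≤ ell D ^ ((2 : ℕ) : ℝ) :=
          Real.rpow_le_rpow_of_exponent_le hℓ1 (by norm_num)
      _ = ell D ^ 2 := Real.rpow_natCast _ _
  have h11le9 : ell D ^ (1.1 : ℝ) ≤ ell D ^ 9 := by
    calc ell D ^ (1.1 : ℝ) ≤ ell D ^ ((9 : ℕ) : ℝ) :=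
          Real.rpow_le_rpow_of_exponent_le hℓ1 (by norm_num)
      _ = ell D ^ 9 := Real.rpow_natCast _ _
  have h11one : (1 : ℝ) ≤ ell D ^ (1.1 : ℝ) := by linarith
  have hT1 : 1 ≤ bigT D := by rw [hT]; exact Real.one_le_exp (by positivity)
  have hT2 : 2 ≤ bigT D := by rw [hT]; linarith [Real.add_one_le_exp (ell D ^ (1.1 : ℝ))]
  set N : ℕ := ⌈2 * bigT D ^ 2⌉₊ with hN
  have hTsq : bigT D ^ 2 = Real.exp (2 * ell D ^ (1.1 : ℝ)) := by
    rw [hT, ← Real.exp_nat_mul]; norm_num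
  have h2T2pos : 0 ≤ 2 * bigT D ^ 2 := by positivity
  have hceil : ((N : ℕ) : ℝ) ≤ 2 * bigT D ^ 2 + 1 := (Nat.ceil_lt_add_one h2T2pos).le
  have hceil' : 2 * bigT D ^ 2 ≤ ((N : ℕ) : ℝ) := Nat.le_ceil _
  -- `D⁴ ≤ 2T²`
  have hD4N : D ^ 4 ≤ N := by
    have h : ((D ^ 4 : ℕ) : ℝ) ≤ 2 * bigT D ^ 2 := by
      rw [hD4r, hTsq]
      have : Real.exp (4 * ell D) ≤ Real.exp (2 * ell D ^ (1.1 : ℝ)) :=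
        Real.exp_le_exp.mpr (by linarith)
      linarith [Real.exp_pos (2 * ell D ^ (1.1 : ℝ))]
    exact_mod_cast h.trans hceil'
  -- `N ≤ e^{2𝓛⁹}`: `2T² + 1 ≤ 3e^{2𝓛^{1.1}} ≤ e^{2}·e^{2𝓛^{1.1}}… ≤ e^{2𝓛⁹}` since `2𝓛^{1.1} + 2 ≤ 2𝓛⁹`
  have hNexp : ((N : ℕ) : ℝ) ≤ Real.exp (2 * Real.log D ^ 9) := by
    refine hceil.trans ?_
    rw [← ell, hTsq]
    have h3 : 2 * Real.exp (2 * ell D ^ (1.1 : ℝ)) + 1 ≤ 3 * Real.exp (2 * ell D ^ (1.1 : ℝ)) := by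
      linarith [Real.one_le_exp (show 0 ≤ 2 * ell D ^ (1.1 : ℝ) by positivity)]
    refine h3.trans ?_
    have h3e : (3 : ℝ) ≤ Real.exp 2 := by
      have := Real.add_one_le_exp (2 : ℝ); linarith
    have h9 : (1 : ℝ) ≤ ell D ^ 9 := one_le_pow₀ hℓ1
    have h97 : ell D ^ 9 = ell D ^ 2 * ell D ^ 7 := by ring
    have h7 : 2 ≤ ell D ^ 7 := le_trans (by linarith) (le_self_pow₀ hℓ1 (by norm_num) : ell D ≤ ell D ^ 7)
    have hsq : 1 ≤ ell D ^ 2 := one_le_pow₀ hℓ1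
    have h92 : 2 * ell D ^ 2 ≤ ell D ^ 9 := by rw [h97]; nlinarith
    calc 3 * Real.exp (2 * ell D ^ (1.1 : ℝ)) ≤ Real.exp 2 * Real.exp (2 * ell D ^ (1.1 : ℝ)) := by
          gcongr
      _ = Real.exp (2 + 2 * ell D ^ (1.1 : ℝ)) := by rw [← Real.exp_add]
      _ ≤ Real.exp (2 * ell D ^ 9) := Real.exp_le_exp.mpr (by nlinarith)
  -- `N ≤ T⁵`: `2T² + 1 ≤ T²(T³)` as `T ≥ 2`
  have hNT5 : ((N : ℕ) : ℝ) ≤ bigT D ^ 5 := by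
    refine hceil.trans ?_
    have hT3 : 3 ≤ bigT D ^ 3 := by
      calc (3 : ℝ) ≤ 2 ^ 3 := by norm_num
        _ ≤ bigT D ^ 3 := pow_le_pow_left₀ (by norm_num) hT2 3
    have hTsq1 : 1 ≤ bigT D ^ 2 := one_le_pow₀ hT1
    nlinarith
  have hN2 : 2 ≤ N := by
    have h : (2 : ℝ) ≤ 2 * bigT D ^ 2 := by nlinarith [one_le_pow₀ (M₀ := ℝ) hT1 (n := 2)]
    exact_mod_cast h.trans hceil'
  -- `log(N+1) ≤ log(4T²) = log 4 + 2𝓛^{1.1} ≤ 2𝓛^{1.1} + 3`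
  have hlogN1 : Real.log ((N + 1 : ℕ) : ℝ) ≤ 2 * ell D ^ (1.1 : ℝ) + 3 := by
    have hN1 : ((N + 1 : ℕ) : ℝ) ≤ 4 * bigT D ^ 2 := by
      push_cast
      have hTsq1 : 1 ≤ bigT D ^ 2 := one_le_pow₀ hT1
      linarith
    have hpos : (0 : ℝ) < ((N + 1 : ℕ) : ℝ) := by positivity
    have hlog4 : Real.log 4 ≤ 3 := by
      have hexp : (4 : ℝ) ≤ Real.exp 3 := by
        have := Real.add_one_le_exp (3 : ℝ); linarith
      have := Real.log_le_log (by norm_num) hexp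
      rwa [Real.log_exp] at this
    calc Real.log ((N + 1 : ℕ) : ℝ) ≤ Real.log (4 * bigT D ^ 2) := Real.log_le_log hpos hN1
      _ = Real.log 4 + 2 * ell D ^ (1.1 : ℝ) := by
          rw [Real.log_mul (by norm_num) (by positivity), hTsq, Real.log_exp]
      _ ≤ 2 * ell D ^ (1.1 : ℝ) + 3 := by linarith
  exact ⟨hD2, hD42, hD4N, hNexp, hNT5, hN2, hlogN1, h11le2, hT1⟩

/-- `𝓛⁷ ≤ D⁴` once `𝓛 ≥ 8!` (`𝓛⁸/8! ≤ e^{𝓛} = D`, so `𝓛⁷ ≤ 8!·D/𝓛 ≤ D ≤ D⁴`). [folklore] -/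
private theorem ell_pow_seven_le_pow_four' {D : ℕ} (hD : 1 ≤ D) (hℓ : (40320 : ℝ) ≤ ell D) :
    ell D ^ 7 ≤ ((D ^ 4 : ℕ) : ℝ) := by
  have hD0 : (0 : ℝ) < D := by exact_mod_cast hD
  have hD1 : (1 : ℝ) ≤ D := by exact_mod_cast hD
  have hℓ0 : 0 ≤ ell D := Real.log_nonneg hD1
  have h := Real.pow_div_factorial_le_exp (ell D) hℓ0 8
  rw [ell, Real.exp_log hD0, ← ell] at h
  have h8 : (Nat.factorial 8 : ℝ) = 40320 := by
    have : Nat.factorial 8 = 40320 := rfl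
    rw [this]; norm_num
  rw [h8, div_le_iff₀ (by norm_num)] at h
  have hD4 : (D : ℝ) ≤ ((D ^ 4 : ℕ) : ℝ) := by
    push_cast; exact le_self_pow₀ hD1 (by norm_num)
  refine le_trans ?_ hD4
  -- `ℓ⁷ · 40320 ≤ ℓ⁷ · ℓ = ℓ⁸ ≤ 40320 · D`
  have h7 : 0 ≤ ell D ^ 7 := by positivity
  nlinarith [mul_le_mul_of_nonneg_left hℓ h7]

/-- `e^x − 1 ≤ x·e^x` for all real `x`. [folklore] -/
private theorem exp_sub_one_le_mul_exp' (x : ℝ) : Real.exp x - 1 ≤ x * Real.exp x := by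
  have h := Real.add_one_le_exp (-x)
  rw [Real.exp_neg] at h
  have hpos := Real.exp_pos x
  have : (-x + 1) * Real.exp x ≤ 1 := by
    calc (-x + 1) * Real.exp x ≤ (Real.exp x)⁻¹ * Real.exp x :=
          mul_le_mul_of_nonneg_right h hpos.le
      _ = 1 := inv_mul_cancel₀ hpos.ne'
  nlinarith

/-! ## §2. The term `l = 1` -/

/-- `|b₃| ≤ 3(1 + |c′|π)·α` (`b₃ = 3α(1 − c′α𝓛)`, `α𝓛 = π𝓛⁻⁸ ≤ π` for `𝓛 ≥ 1`).
[cite: Zhang2022LandauSiegel, §2 (2.10)] -/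
theorem abs_b3_le {D : ℕ} (hℓ : 1 ≤ ell D) : |b3 c' D| ≤ 3 * (1 + |c'| * Real.pi) * alpha D := by
  have hℓ0 : 0 < ell D := by linarith
  have hα0 : 0 < alpha D := Skeleton.alpha_pos_of_ell_pos hℓ0
  have hα9 := Skeleton.alpha_mul_ell_pow_nine (D := D) hℓ0
  have hαℓ : alpha D * ell D ≤ Real.pi := by
    have h8 : (1 : ℝ) ≤ ell D ^ 8 := one_le_pow₀ hℓ
    have : alpha D * ell D * ell D ^ 8 = Real.pi := by rw [← hα9]; ring
    nlinarith [mul_pos hα0 hℓ0]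
  rw [b3, abs_mul, abs_mul, abs_of_pos hα0, show |(3 : ℝ)| = 3 by norm_num]
  have h1 : |1 - c' * alpha D * ell D| ≤ 1 + |c'| * Real.pi := by
    calc |1 - c' * alpha D * ell D| ≤ |(1 : ℝ)| + |c' * alpha D * ell D| := abs_sub _ _
      _ = 1 + |c'| * (alpha D * ell D) := by
          rw [abs_one, mul_assoc, abs_mul,
            abs_of_nonneg (show (0 : ℝ) ≤ alpha D * ell D by positivity)]
      _ ≤ 1 + |c'| * Real.pi := by gcongr
  calc 3 * alpha D * |1 - c' * alpha D * ell D| ≤ 3 * alpha D * (1 + |c'| * Real.pi) := by gcongr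
    _ = 3 * (1 + |c'| * Real.pi) * alpha D := by ring

/-- `‖l₁^{−β₃} − 1‖ ≤ |b₃|·log l₁` for `l₁ ≥ 1` (`β₃ = ib₃`; `|e^{iθ} − 1| ≤ |θ|`, tree
`MeanSquareMajorant.norm_powI_sub_one_le`). [cite: Zhang2022LandauSiegel, §16 (16.14) p. 93] -/
theorem norm_cpow_neg_beta3_sub_one_le {D l₁ : ℕ} (hl₁ : 0 < l₁) :
    ‖(l₁ : ℂ) ^ (-beta3 c' D) - 1‖ ≤ |b3 c' D| * Real.log l₁ := by
  have h := MeanSquareMajorant.norm_powI_sub_one_le (b3 c' D) hl₁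
  rw [MeanSquareMajorant.powI_apply_of_ne_zero _ hl₁.ne'] at h
  rw [beta3_eq_b3_mul_I]
  exact h

/-- **The term `l = 1`**: for `1 ≤ l₁ < T` (so `T²/l₁ > T ≥ 1`) and `𝓛 ≥ 1`,
`‖l₁^{−β₃}·g*(T²/l₁) − 1‖ ≤ |b₃| log l₁ + ½e^{−𝓛³⁰(log(T²/l₁))²}` and the right side is
`≤ 3(1+|c′|π)α·log T + ½e^{−𝓛³⁰}`. We record the consequence `≤ (3π(1+|c′|π) + 1)𝓛⁻⁷`.
[cite: Zhang2022LandauSiegel, §16 (16.14) p. 93; §4 (4.2)] -/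
theorem norm_termOne_sub_one_le {D l₁ : ℕ} (hℓ : (4 : ℝ) ^ 10 ≤ ell D) (hl₁ : 1 ≤ l₁)
    (hl₁T : (l₁ : ℝ) < bigT D) :
    ‖(1 : ℂ) / (((1 : ℕ) : ℂ) * (((l₁ * 1 : ℕ) : ℂ)) ^ beta3 c' D) *
        (gstar D (bigT D ^ 2 / ((l₁ * 1 : ℕ) : ℝ)) : ℂ) - 1‖ ≤
      (3 * Real.pi * (1 + |c'| * Real.pi) + 1) * (ell D ^ 7)⁻¹ := by
  obtain ⟨-, -, -, -, -, -, -, h11le2, hT1⟩ := innerSum_sizes hℓ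
  have h410 : (4 : ℝ) ^ 10 = 1048576 := by norm_num
  have hℓ1 : 1 ≤ ell D := by linarith
  have hℓ0 : 0 < ell D := by linarith
  have hl₁0 : 0 < l₁ := hl₁
  have hl₁r : (0 : ℝ) < l₁ := by exact_mod_cast hl₁0
  rw [mul_one, Nat.cast_one, one_mul]
  -- `u = l₁^{−β₃}`, unimodular
  have hu : (1 : ℂ) / (l₁ : ℂ) ^ beta3 c' D = (l₁ : ℂ) ^ (-beta3 c' D) := by
    rw [Complex.cpow_neg, one_div]
  rw [hu]
  set u : ℂ := (l₁ : ℂ) ^ (-beta3 c' D) with hu_def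
  have hu1 : ‖u - 1‖ ≤ |b3 c' D| * Real.log l₁ := norm_cpow_neg_beta3_sub_one_le c' hl₁0
  -- the weight
  set y : ℝ := bigT D ^ 2 / (l₁ : ℝ) with hy
  have hyT : bigT D ≤ y := by
    rw [hy, le_div_iff₀ hl₁r]
    calc bigT D * l₁ ≤ bigT D * bigT D := mul_le_mul_of_nonneg_left hl₁T.le (by linarith)
      _ = bigT D ^ 2 := by ring
  have hT : bigT D = Real.exp (ell D ^ (1.1 : ℝ)) := rfl
  have h11one : (1 : ℝ) ≤ ell D ^ (1.1 : ℝ) := by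
    calc (1 : ℝ) ≤ ell D := hℓ1
      _ = ell D ^ (1 : ℝ) := (Real.rpow_one _).symm
      _ ≤ ell D ^ (1.1 : ℝ) := Real.rpow_le_rpow_of_exponent_le hℓ1 (by norm_num)
  have hTe : Real.exp 1 ≤ bigT D := by rw [hT]; exact Real.exp_le_exp.mpr h11one
  have hy1 : 1 ≤ y := le_trans hT1 hyT
  have hyhalf : 1 / 2 < y := by linarith
  have hlogy : 1 ≤ Real.log y := by
    have := Real.log_le_log (Real.exp_pos 1) (hTe.trans hyT)
    rwa [Real.log_exp] at this
  have hg : gstar D y = gW D y := by rw [gstar, if_pos hyhalf]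
  have h30 : 0 < ell D ^ 30 := pow_pos hℓ0 30
  have hg1 : |gW D y - 1| ≤ (1 / 2) * Real.exp (-(ell D ^ 30) * Real.log y ^ 2) :=
    GaussWeight.abs_gWeight_sub_one_le h30 hy1
  have hgle1 : |gW D y| ≤ 1 := by
    rw [gW, abs_of_pos (GaussWeight.gWeight_pos h30 y)]
    exact (GaussWeight.gWeight_lt_one h30 y).le
  -- `e^{−𝓛³⁰ log²y} ≤ e^{−𝓛³⁰} ≤ 1/𝓛³⁰ ≤ 1/𝓛⁷`
  have hexp : Real.exp (-(ell D ^ 30) * Real.log y ^ 2) ≤ (ell D ^ 7)⁻¹ := by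
    have h1 : Real.exp (-(ell D ^ 30) * Real.log y ^ 2) ≤ Real.exp (-(ell D ^ 30)) := by
      refine Real.exp_le_exp.mpr ?_
      have : 1 ≤ Real.log y ^ 2 := one_le_pow₀ hlogy
      nlinarith
    have h2 : Real.exp (-(ell D ^ 30)) ≤ (ell D ^ 30)⁻¹ := by
      rw [Real.exp_neg]
      exact inv_anti₀ h30 (by linarith [Real.add_one_le_exp (ell D ^ 30)])
    have h3 : (ell D ^ 30)⁻¹ ≤ (ell D ^ 7)⁻¹ :=
      inv_anti₀ (pow_pos hℓ0 7) (pow_le_pow_right₀ hℓ1 (by norm_num))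
    exact h1.trans (h2.trans h3)
  -- `|b₃| log l₁ ≤ 3(1+|c′|π)α·𝓛^{1.1} ≤ 3(1+|c′|π)π/𝓛⁷`
  have hα0 : 0 < alpha D := Skeleton.alpha_pos_of_ell_pos hℓ0
  have hα9 := Skeleton.alpha_mul_ell_pow_nine (D := D) hℓ0
  have hlogl₁ : Real.log l₁ ≤ ell D ^ (1.1 : ℝ) := by
    have := Real.log_le_log hl₁r hl₁T.le
    rw [hT, Real.log_exp] at this
    exact this
  have hlogl₁0 : 0 ≤ Real.log l₁ := Real.log_natCast_nonneg _
  have hb3 := abs_b3_le c' hℓ1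
  have hmain1 : |b3 c' D| * Real.log l₁ ≤ 3 * Real.pi * (1 + |c'| * Real.pi) * (ell D ^ 7)⁻¹ := by
    calc |b3 c' D| * Real.log l₁ ≤ (3 * (1 + |c'| * Real.pi) * alpha D) * ell D ^ 2 := by
          gcongr; exact hlogl₁.trans h11le2
      _ = 3 * (1 + |c'| * Real.pi) * (alpha D * ell D ^ 9) * (ell D ^ 7)⁻¹ := by
          field_simp
      _ = 3 * Real.pi * (1 + |c'| * Real.pi) * (ell D ^ 7)⁻¹ := by rw [hα9]; ring
  -- assemble: `u·g − 1 = (u − 1)·g + (g − 1)`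
  rw [hg]
  have e : u * ((gW D y : ℝ) : ℂ) - 1 = (u - 1) * ((gW D y : ℝ) : ℂ) + (((gW D y - 1 : ℝ)) : ℂ) := by
    push_cast; ring
  rw [e]
  calc ‖(u - 1) * ((gW D y : ℝ) : ℂ) + (((gW D y - 1 : ℝ)) : ℂ)‖
      ≤ ‖(u - 1) * ((gW D y : ℝ) : ℂ)‖ + ‖(((gW D y - 1 : ℝ)) : ℂ)‖ := norm_add_le _ _
    _ = ‖u - 1‖ * |gW D y| + |gW D y - 1| := by
        rw [norm_mul, Complex.norm_real, Complex.norm_real, Real.norm_eq_abs, Real.norm_eq_abs]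
    _ ≤ (|b3 c' D| * Real.log l₁) * 1 + (1 / 2) * Real.exp (-(ell D ^ 30) * Real.log y ^ 2) := by
        gcongr
    _ ≤ 3 * Real.pi * (1 + |c'| * Real.pi) * (ell D ^ 7)⁻¹ + (1 / 2) * (ell D ^ 7)⁻¹ := by
        rw [mul_one]; gcongr
    _ ≤ (3 * Real.pi * (1 + |c'| * Real.pi) + 1) * (ell D ^ 7)⁻¹ := by
        have : 0 ≤ (ell D ^ 7)⁻¹ := by positivity
        nlinarith

/-! ## §3. The node from the rough multiplicative majorant (R) -/

open scoped Classical in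
/-- **"The innermost sum in (16.14) is `1 + O(𝓛⁻⁷)`" (local reading) from the rough multiplicative
majorant (R)** — EDGE `(R) → Typed.Section16B.Inline16_innerSum1614L c′`, (R) spelled inline (the
text of record, Sketch5 S8 = hypothesis `hR` of `inline16_nsetRemovable_core_of_roughMajorant`):
for all large `D` under (A), `j ∈ {1,2}`, `n₁ ∈ 𝔫(𝔮)`, `n₁ < T`, `l₁ ∣ n₁`,
`‖Σ_{(l,𝔮)=1,l<2T²} ϖ₂ⱼ^loc(l)g*(T²/(l₁l))/(l(l₁l)^{β₃}) − 1‖ ≤ C𝓛⁻⁷` with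
`C = 3π(1+|c′|π) + 1 + X₀e^{X₀}`, `X₀ = 3max(C₁,0) + 6πC₀ + 20C₀` (`C₁` = the constant of Lemma 3.1).
[cite: Zhang2022LandauSiegel, §16 p. 94 (u036–u037)] -/
theorem inline16_innerSum1614L_of_roughMajorant
    (hR : ∃ C₀ : ℝ, 0 ≤ C₀ ∧ ForAllLarge fun D _ χ => AssumptionA D χ → ∀ j ∈ ({1, 2} : Finset ℕ),
      ∀ q r : ℕ, q.Prime → ¬ q ∣ frakq D → 1 ≤ r → ((q ^ r : ℕ) : ℝ) < bigT D ^ 5 →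
        ‖varpi2loc c' χ j (q ^ r)‖ * tau3R (q ^ r) ≤
          if r = 1 then 3 * ‖nu χ q‖ + C₀ * (alpha D * Real.log q + (q : ℝ)⁻¹)
            else C₀ * (3 / 2 : ℝ) ^ r) :
    Inline16_innerSum1614L c' := by
  obtain ⟨C₀, hC₀, D₀, hRF⟩ := hR
  obtain ⟨C₁, hC₁⟩ := Lemma31.lemma_3_1
  obtain ⟨D₁, hD₁⟩ := exists_forall_le_ell_is ((4 : ℝ) ^ 10)
  set C₁' : ℝ := max C₁ 0 with hC₁'
  set X₀ : ℝ := 3 * C₁' + 6 * Real.pi * C₀ + 20 * C₀ with hX₀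
  have hC₁'0 : 0 ≤ C₁' := le_max_right _ _
  have hX₀0 : 0 ≤ X₀ := by rw [hX₀]; positivity
  set Kc : ℝ := 3 * Real.pi * (1 + |c'| * Real.pi) + 1 with hKc
  have hKc0 : 0 ≤ Kc := by rw [hKc]; positivity
  refine ⟨Kc + X₀ * Real.exp X₀, max D₀ D₁, fun D _ χ hD hq hp hA j hj n₁ hn₁ hn₁T l₁ hl₁ => ?_⟩
  have hD₀ : D₀ ≤ D := le_trans (le_max_left _ _) hD
  have hℓ : (4 : ℝ) ^ 10 ≤ ell D := hD₁ D (le_trans (le_max_right _ _) hD)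
  have eR := hRF D χ hD₀ hq hp hA j hj
  obtain ⟨hD2, hD42, hN4, hNexp, hNT5, hN2, hlogN1, h11le2, hT1⟩ := innerSum_sizes hℓ
  have h410 : (4 : ℝ) ^ 10 = 1048576 := by norm_num
  have hℓ1 : 1 ≤ ell D := by linarith
  have hℓ0 : 0 < ell D := by linarith
  have hℓ3 : 3 ≤ Real.log D := by rw [← ell]; linarith
  have hD1 : 1 ≤ D := by omega
  -- notation
  set N : ℕ := ⌈2 * bigT D ^ 2⌉₊ with hN
  set K : ℕ := frakq D with hK
  set S := (Finset.Ico 1 N).filter (fun l => Nat.Coprime l K) with hS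
  set R := (Finset.Ico 2 N).filter (fun b => Nat.Coprime b K) with hR
  set F : ℕ → ℂ := fun l => varpi2loc c' χ j l / ((l : ℂ) * (((l₁ * l : ℕ) : ℂ)) ^ beta3 c' D) *
    (gstar D (bigT D ^ 2 / ((l₁ * l : ℕ) : ℝ)) : ℂ) with hF
  -- facts on `l₁`
  have hl₁pos : 1 ≤ l₁ := Nat.pos_of_mem_divisors hl₁
  have hn₁0 : 0 < n₁ := hn₁.1
  have hl₁T : (l₁ : ℝ) < bigT D := by
    have h := Nat.le_of_dvd hn₁0 (Nat.dvd_of_mem_divisors hl₁)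
    exact lt_of_le_of_lt (by exact_mod_cast h) hn₁T
  -- Step 1: split off `l = 1`
  have h1S : 1 ∈ S := by
    rw [hS, Finset.mem_filter, Finset.mem_Ico]
    exact ⟨⟨le_refl 1, by omega⟩, Nat.coprime_one_left K⟩
  have herase : S.erase 1 ⊆ R := by
    intro l hl
    rw [Finset.mem_erase, hS, Finset.mem_filter, Finset.mem_Ico] at hl
    rw [hR, Finset.mem_filter, Finset.mem_Ico]
    exact ⟨⟨by omega, hl.2.1.2⟩, hl.2.2⟩
  have hsplit : ∑ l ∈ S, F l = F 1 + ∑ l ∈ S.erase 1, F l := (Finset.add_sum_erase S F h1S).symm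
  -- Step 2: the term `l = 1`
  have hterm1 : ‖F 1 - 1‖ ≤ Kc * (ell D ^ 7)⁻¹ := by
    have h := norm_termOne_sub_one_le c' (D := D) hℓ hl₁pos hl₁T
    rw [hF]; dsimp only
    rw [varpi2loc_one]
    exact h
  -- Step 3: the terms `l ≥ 2`, termwise `‖F l‖ ≤ ‖ϖ^loc(l)‖τ₃(l)/l`
  have hτ0 : ∀ n : ℕ, 0 ≤ tau3R n := fun n =>
    Finset.sum_nonneg (fun x (_ : x ∈ n.divisors) => (Nat.cast_nonneg (α := ℝ) x.divisors.card))
  have hτ1 : ∀ n : ℕ, 1 ≤ n → 1 ≤ tau3R n := by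
    intro n hn
    unfold tau3R
    have h1 : (1 : ℕ) ∈ n.divisors := Nat.one_mem_divisors.mpr (by omega)
    calc (1 : ℝ) = ((1 : ℕ).divisors.card : ℝ) := by simp
      _ ≤ ∑ m ∈ n.divisors, (m.divisors.card : ℝ) :=
          Finset.single_le_sum (f := fun m : ℕ => (m.divisors.card : ℝ)) (fun _ _ => Nat.cast_nonneg _) h1
  have htermR : ∀ l ∈ R, ‖F l‖ ≤ ‖varpi2loc c' χ j l‖ * tau3R l / l := by
    intro l hl
    rw [hR, Finset.mem_filter, Finset.mem_Ico] at hl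
    obtain ⟨⟨hl2, -⟩, -⟩ := hl
    have hl0 : (0 : ℝ) < l := by exact_mod_cast (show 0 < l by omega)
    have hl₁l : 1 ≤ l₁ * l := Nat.one_le_iff_ne_zero.mpr (Nat.mul_ne_zero (by omega) (by omega))
    rw [hF]; dsimp only
    rw [norm_mul, norm_div, norm_mul, Complex.norm_natCast,
      show beta3 c' D = betaJ c' D 3 by simp [betaJ],
      Typed.Section15B.norm_natCast_cpow_betaJ c' D 3 hl₁l, mul_one]
    have hg : ‖(gstar D (bigT D ^ 2 / ((l₁ * l : ℕ) : ℝ)) : ℂ)‖ ≤ 1 := by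
      rw [Complex.norm_real, Real.norm_eq_abs, gstar]
      split_ifs
      · have h30 : 0 < ell D ^ 30 := pow_pos hℓ0 30
        rw [gW, abs_of_pos (GaussWeight.gWeight_pos h30 _)]
        exact (GaussWeight.gWeight_lt_one h30 _).le
      · simp
    calc ‖varpi2loc c' χ j l‖ / (l : ℝ) * ‖(gstar D (bigT D ^ 2 / ((l₁ * l : ℕ) : ℝ)) : ℂ)‖
        ≤ ‖varpi2loc c' χ j l‖ / (l : ℝ) * 1 :=
          mul_le_mul_of_nonneg_left hg (div_nonneg (norm_nonneg _) hl0.le)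
      _ ≤ ‖varpi2loc c' χ j l‖ * tau3R l / l := by
          rw [mul_one]
          exact div_le_div_of_nonneg_right
            (le_mul_of_one_le_right (norm_nonneg _) (hτ1 l (by omega))) hl0.le
  set Rh : ℝ := ∑ b ∈ R, ‖varpi2loc c' χ j b‖ * tau3R b / b with hRh
  have hrest : ‖∑ l ∈ S.erase 1, F l‖ ≤ Rh := by
    calc ‖∑ l ∈ S.erase 1, F l‖ ≤ ∑ l ∈ S.erase 1, ‖F l‖ := norm_sum_le _ _
      _ ≤ ∑ l ∈ R, ‖F l‖ := Finset.sum_le_sum_of_subset_of_nonneg herase fun l _ _ => norm_nonneg _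
      _ ≤ Rh := Finset.sum_le_sum htermR
  -- Step 4: the rough sum under (R)
  set s : Finset ℕ := Nat.primesLE N \ Nat.primesLE (D ^ 4 - 1) with hs_def
  set x : ℝ := ∑ q ∈ s, ((3 * ‖nu χ q‖ + C₀ * (alpha D * Real.log q + (q : ℝ)⁻¹)) / q +
      9 * C₀ / (q : ℝ) ^ 2) with hx
  have step5 : Rh ≤ Real.exp x - 1 :=
    sum_rough_varpi2loc_tau3R_div_le c' χ j hC₀ hD42 hN4 hNT5 eR
  -- Step 5: the exponent `x ≤ X₀/𝓛⁷`
  have hα0 : 0 < alpha D := Skeleton.alpha_pos_of_ell_pos hℓ0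
  have hD4np : ¬ (D ^ 4).Prime := by
    intro h
    have h2 : D ^ 2 ∣ D ^ 4 := pow_dvd_pow D (by norm_num)
    rcases (Nat.dvd_prime h).mp h2 with h1 | h4
    · have : 4 ≤ D ^ 2 := by nlinarith
      omega
    · have hD2' : D ^ 2 < D ^ 4 := Nat.pow_lt_pow_right (by omega) (by norm_num)
      omega
  have hs_prime : ∀ q ∈ s, q.Prime ∧ D ^ 4 < q ∧ q ≤ N := by
    intro q hq
    rw [hs_def, Finset.mem_sdiff, Nat.mem_primesLE, Nat.mem_primesLE] at hq
    obtain ⟨⟨hqN, hqp⟩, hnot⟩ := hq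
    have hge : D ^ 4 ≤ q := by
      by_contra hlt
      exact hnot ⟨by omega, hqp⟩
    refine ⟨hqp, ?_, hqN⟩
    rcases hge.eq_or_lt with h | h
    · exact absurd (h ▸ hqp) hD4np
    · exact h
  -- (5a) the `ν`-part via Lemma 3.1
  have h6a : ∑ q ∈ s, 3 * ‖nu χ q‖ / q ≤ 3 * (C₁' / ell D ^ 7) := by
    have hAle : ‖χ.LFunction 1‖ ≤ 1 / Real.log D ^ 2022 := by
      have := hA; rw [AssumptionA] at this; exact this.le
    have h31 := hC₁ D χ hp hq.sq_eq_one hℓ3 hAle N hNexp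
    have hsub : s ⊆ Finset.Ioc (D ^ 4) N := by
      intro q hq
      obtain ⟨-, h1, h2⟩ := hs_prime q hq
      exact Finset.mem_Ioc.mpr ⟨h1, h2⟩
    have hν : ∀ q ∈ s, ‖nu χ q‖ / q ≤ ‖nu χ q‖ ^ 2 / q := fun q hqs =>
      div_le_div_of_nonneg_right (norm_nu_prime_le_sq χ hq (hs_prime q hqs).1) (Nat.cast_nonneg q)
    have hpow7 : C₁ / Real.log D ^ 2011 ≤ C₁' / ell D ^ 7 := by
      rw [← ell]
      calc C₁ / ell D ^ 2011 ≤ C₁' / ell D ^ 2011 :=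
            div_le_div_of_nonneg_right (le_max_left _ _) (by positivity)
        _ ≤ C₁' / ell D ^ 7 :=
            div_le_div_of_nonneg_left hC₁'0 (by positivity) (pow_le_pow_right₀ hℓ1 (by norm_num))
    calc ∑ q ∈ s, 3 * ‖nu χ q‖ / q = 3 * ∑ q ∈ s, ‖nu χ q‖ / q := by
          rw [Finset.mul_sum]; exact Finset.sum_congr rfl fun q _ => by ring
      _ ≤ 3 * ∑ q ∈ s, ‖nu χ q‖ ^ 2 / q :=
          mul_le_mul_of_nonneg_left (Finset.sum_le_sum hν) (by norm_num)
      _ ≤ 3 * ∑ n ∈ Finset.Ioc (D ^ 4) N, ‖nu χ n‖ ^ 2 / n :=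
          mul_le_mul_of_nonneg_left
            (Finset.sum_le_sum_of_subset_of_nonneg hsub fun n _ _ => by positivity) (by norm_num)
      _ ≤ 3 * (C₁ / Real.log D ^ 2011) := mul_le_mul_of_nonneg_left h31 (by norm_num)
      _ ≤ 3 * (C₁' / ell D ^ 7) := mul_le_mul_of_nonneg_left hpow7 (by norm_num)
  -- (5b) the `α log q`-part via Mertens I: `Σ_{q≤N} log q/q ≤ log(N+1) + log 4 ≤ 2𝓛^{1.1} + 6 ≤ 6𝓛²`
  have h6b : ∑ q ∈ s, C₀ * (alpha D * Real.log q) / q ≤ 6 * Real.pi * C₀ / ell D ^ 7 := by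
    have hsub : s ⊆ Nat.primesBelow (N + 1) := by
      intro q hq
      rw [hs_def, Finset.mem_sdiff] at hq
      exact hq.1
    have hM : ∑ q ∈ s, Real.log q / q ≤ Real.log ((N + 1 : ℕ) : ℝ) + Real.log 4 :=
      (Finset.sum_le_sum_of_subset_of_nonneg hsub fun q _ _ =>
        div_nonneg (Real.log_natCast_nonneg q) (Nat.cast_nonneg q)).trans
        (sum_primesBelow_log_div_le (N + 1))
    have hlog4 : Real.log 4 ≤ 3 := by
      have hexp : (4 : ℝ) ≤ Real.exp 3 := by
        have := Real.add_one_le_exp (3 : ℝ); linarith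
      have := Real.log_le_log (by norm_num) hexp
      rwa [Real.log_exp] at this
    have hsumlog : ∑ q ∈ s, Real.log q / q ≤ 6 * ell D ^ 2 := by
      have h2 : (4 : ℝ) ≤ ell D ^ 2 := by nlinarith
      linarith
    have hα9 := Skeleton.alpha_mul_ell_pow_nine (D := D) hℓ0
    calc ∑ q ∈ s, C₀ * (alpha D * Real.log q) / q
        = C₀ * alpha D * ∑ q ∈ s, Real.log q / q := by
          rw [Finset.mul_sum]; exact Finset.sum_congr rfl fun q _ => by ring
      _ ≤ C₀ * alpha D * (6 * ell D ^ 2) := mul_le_mul_of_nonneg_left hsumlog (by positivity)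
      _ = 6 * Real.pi * C₀ / ell D ^ 7 := by
          have hα : alpha D = Real.pi / ell D ^ 9 := by
            rw [← hα9]; field_simp
          rw [hα]
          field_simp
  -- (5c) the `1/q²`-part
  have h6c : ∑ q ∈ s, (C₀ * (q : ℝ)⁻¹ / q + 9 * C₀ / (q : ℝ) ^ 2) ≤ 20 * C₀ / ell D ^ 7 := by
    have hsub : s ⊆ Finset.Ioo (D ^ 4 - 1) (N + 1) := by
      intro q hq
      obtain ⟨-, h1, h2⟩ := hs_prime q hq
      exact Finset.mem_Ioo.mpr ⟨by omega, by omega⟩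
    have hsq : ∑ q ∈ s, ((q : ℝ) ^ 2)⁻¹ ≤ 2 / ((D ^ 4 : ℕ) : ℝ) := by
      have h := sum_Ioo_inv_sq_le (α := ℝ) (D ^ 4 - 1) (N + 1)
      have hcast : (((D ^ 4 - 1 : ℕ) : ℝ) + 1) = ((D ^ 4 : ℕ) : ℝ) := by
        have : 1 ≤ D ^ 4 := Nat.one_le_pow _ _ (by omega)
        rw [Nat.cast_sub this]; push_cast; ring
      rw [hcast] at h
      exact (Finset.sum_le_sum_of_subset_of_nonneg hsub fun q _ _ => by positivity).trans h
    have h7 := ell_pow_seven_le_pow_four' hD1 (le_trans (by norm_num) hℓ)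
    have hD4pos : (0 : ℝ) < ((D ^ 4 : ℕ) : ℝ) := by positivity
    calc ∑ q ∈ s, (C₀ * (q : ℝ)⁻¹ / q + 9 * C₀ / (q : ℝ) ^ 2)
        = 10 * C₀ * ∑ q ∈ s, ((q : ℝ) ^ 2)⁻¹ := by
          rw [Finset.mul_sum]; refine Finset.sum_congr rfl fun q hq => ?_
          have hq0 : (q : ℝ) ≠ 0 := by
            have := (hs_prime q hq).1.pos; exact_mod_cast this.ne'
          field_simp; ring
      _ ≤ 10 * C₀ * (2 / ((D ^ 4 : ℕ) : ℝ)) := mul_le_mul_of_nonneg_left hsq (by positivity)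
      _ ≤ 10 * C₀ * (2 / ell D ^ 7) := by
          refine mul_le_mul_of_nonneg_left ?_ (by positivity)
          exact div_le_div_of_nonneg_left (by norm_num) (by positivity) h7
      _ = 20 * C₀ / ell D ^ 7 := by ring
  have hxle : x ≤ X₀ / ell D ^ 7 := by
    have hxsplit : x = ∑ q ∈ s, 3 * ‖nu χ q‖ / q + ∑ q ∈ s, C₀ * (alpha D * Real.log q) / q +
        ∑ q ∈ s, (C₀ * (q : ℝ)⁻¹ / q + 9 * C₀ / (q : ℝ) ^ 2) := by
      rw [hx, ← Finset.sum_add_distrib, ← Finset.sum_add_distrib]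
      exact Finset.sum_congr rfl fun q _ => by ring
    rw [hxsplit, hX₀]
    have := add_le_add (add_le_add h6a h6b) h6c
    refine this.trans (le_of_eq ?_)
    field_simp
  have hx0 : 0 ≤ x := by
    rw [hx]
    refine Finset.sum_nonneg fun q _ => ?_
    have := Real.log_natCast_nonneg q
    positivity
  have hxX₀ : x ≤ X₀ := by
    refine hxle.trans ?_
    rw [div_le_iff₀ (by positivity)]
    have : (1 : ℝ) ≤ ell D ^ 7 := one_le_pow₀ hℓ1
    exact le_mul_of_one_le_right hX₀0 this
  have step7 : Rh ≤ X₀ / ell D ^ 7 * Real.exp X₀ := by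
    calc Rh ≤ Real.exp x - 1 := step5
      _ ≤ x * Real.exp x := exp_sub_one_le_mul_exp' x
      _ ≤ X₀ / ell D ^ 7 * Real.exp X₀ :=
          mul_le_mul hxle (Real.exp_le_exp.mpr hxX₀) (Real.exp_pos x).le (by positivity)
  -- Step 6: assemble
  rw [hsplit]
  have e : F 1 + ∑ l ∈ S.erase 1, F l - 1 = (F 1 - 1) + ∑ l ∈ S.erase 1, F l := by ring
  rw [e]
  calc ‖(F 1 - 1) + ∑ l ∈ S.erase 1, F l‖
      ≤ ‖F 1 - 1‖ + ‖∑ l ∈ S.erase 1, F l‖ := norm_add_le _ _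
    _ ≤ Kc * (ell D ^ 7)⁻¹ + X₀ / ell D ^ 7 * Real.exp X₀ := add_le_add hterm1 (hrest.trans step7)
    _ = (Kc + X₀ * Real.exp X₀) * (ell D ^ 7)⁻¹ := by ring

end Literature.NumberTheory.LFunctions.Zhang2022.Typed.Section16B
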